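import Literature.AlgebraicGeometry.AbelianSchemes.PolarizationLawAtFieldPoint   -- ★ (G-λ) `comp_mulN_eq_mulN_comp`, `inv_comp_lam_comp_dualIsogenyOver_inv_of_eq`, `dualIsogenyOver_comp`
import HarnessLib

/-!
# An ISOGENY ROOF `A_y —q→ B ←c— A_{y″}` read on `Ω`-points TRANSPORTS along isomorphisms of the outer fibres exact on `λ`, `ι`, level

Topic `AlgebraicGeometry/AbelianSchemes`; namespace `Literature.AlgebraicGeometry.AbelianSchemes.AbelianSchemeOver`.  THEOREMS ONLY
(no definition, no named fact, no instance, no notation, no `sorry`).  Cell `hodgecm-mathlib` (D-0151), P6 «MOD programme», half A line L4,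
closer leaf `Lines/F0_P6a_PELSpread.lean` of the P-LINE socket `stub_SPREAD`, socket `stub_HECKE` (LEAD F0P6-plan (g3) «M-55»; LA4-plan (g0)
DEAL v1 «HECKE TRANSPORT PRIMITIVE»): the CUT-INDEPENDENT per-point core of «`HeckeRoofsΩ` is invariant under a pointwise `TupleIsoAt₂`».
`--supports stmt-HodgeConjecture-24832`, count-neutral.  HONEST LABEL: HC_CM is proved only modulo the 2 remaining named inputs (hLiu418 24832,
h413 24833) until rung 0 closes; this file is general and discharges none of them.

THE MATHEMATICS ([MumfordAV1970] §15 Thm. 1 `(ψ ≫ χ)^∨ = χ^∨ ≫ ψ^∨`; [MumfordFogartyKirwan1994] Ch. 7 §2 Def. 7.2–7.3 «triples up to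
isomorphism»; [Milne2005ShimuraVarieties] §14 pp. 124–125 «`σ(A, i, λ, ηK)`»: every datum attached to a polarised abelian variety with
endomorphisms and level points is carried by an isomorphism respecting `(λ, i, η)`).  Over `Spec Ω` let `e : A₁ ≅ A₂`, `e″ : A₁″ ≅ A₂″` be
isomorphisms of group schemes EXACT on the polarisations in dual-homomorphism form (`e ≫ λ₂ ≫ e^∨ = λ₁`), on the endomorphism families
(`ι₁(a) ≫ e = e ≫ ι₂(a)`) and on chosen families of `Ω`-points (`e(σ₁ᵃ) = σ₂ᵃ`).  Then an ISOGENY ROOF for side 1 — an abelian scheme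
`B∕Ω` with a dual pair and `λ_B : B → B̂`, homomorphisms `q : A₁ → B`, `c : A₁″ → B` with (r1) `Ker q(Ω) = K₁`, (r2) `Ker c(Ω)` = a prescribed
set of points and `c` surjective, (r3) `q ≫ λ_B ≫ q^∨ = λ₁ ≫ [p]`, `c ≫ λ_B ≫ c^∨ = λ₁″ ≫ [p]`, (r4) `ι`-equivariance through a common endomorphism
of `B`, (r5) `q(σ₁ᵃ) = c(σ₁″ᵃ)` — is also an isogeny roof for side 2, with the SAME middle object and `q₂ := e⁻¹ ≫ q`, `c₂ := e″⁻¹ ≫ c`: (r1)(r2)(r5)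
because `e`, `e″` are bijective on points and compatible with the data; (r3) by `(e⁻¹ ≫ q)^∨ = q^∨ ≫ (e⁻¹)^∨`, `[p]` commuting with
homomorphisms and `e⁻¹ ≫ λ₁ ≫ (e⁻¹)^∨ = λ₂` (★ `inv_comp_lam_comp_dualIsogenyOver_inv_of_eq`); (r4) by conjugation.  The clause texts are
VERBATIM those of the P6a Defs reader `RoofΩ` (Defs ED. 3 :361–:408) with the readers abstracted (`schΩOf ↦ Aᵢ`, `fibreΩOf ↦
Aᵢ.toAffine.toAbelianVariety`, `actΩOf … .hom.hom.hom ↦ act`, `IsIdealTorsionΩ ↦ tors`, `lvlPtΩOf ↦ pt`), so the consumer instantiates by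
unification.

* §1 points along an isomorphism of group schemes over `Spec Ω` (`map_inv_map_hom`, `map_hom_map_inv`, `map_one_of_isMonHom`,
  `map_eq_one_iff_of_iso_hom∕inv`, `exists_mulEquiv_points_of_iso`, torsion predicates `forall_map_eq_one_iff_of_iso`);
* §2 (r3) one-sided: `comp_lam_comp_dualIsogenyOver_eq_mulN_of_iso_inv_comp`;
* §3 **`roof_transport_along_iso`** — THE HEAD.

## References
* [MumfordAV1970] D. Mumford, *Abelian Varieties* (1970), §15 Thm. 1 (p. 143); §23 Thm. 2 (p. 231).
* [MumfordFogartyKirwan1994] D. Mumford, J. Fogarty, F. Kirwan, *Geometric Invariant Theory*, 3rd ed. (1994), Ch. 7 §2 Def. 7.2 (p. 129), Def. 7.3 (p. 130).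
* [Milne2005ShimuraVarieties] J. S. Milne, *Introduction to Shimura varieties* (2005), §14 pp. 124–125.
* [MilneAV2008] J. S. Milne, *Abelian Varieties* (2008), I §9 Thm. 9.1 (p. 42).
-/

set_option autoImplicit false

noncomputable section

-- Mathlib's `Over`/pull-back API is stated across semireducible wrappers (as in the ★ `AbelianSchemes/*` files).
set_option backward.isDefEq.respectTransparency false

universe u

open CategoryTheory CategoryTheory.Limits AlgebraicGeometry MonoidalCategory
open scoped MonObj

namespace Literature.AlgebraicGeometry.AbelianSchemes

namespace AbelianSchemeOver

open Literature.AlgebraicGeometry.Motives (AlgPoints)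

/-! ### §1 `Ω`-points along an isomorphism of group schemes over `Spec Ω` -/

section Points

variable {Ω : Type u} [Field Ω] {A₁ A₂ B : AbelianSchemeOver (Spec (.of Ω))} (e : A₁.X ≅ A₂.X)

/-- `e⁻¹(e(P)) = P` on `Ω`-points. [cite: MumfordFogartyKirwan1994, Ch. 7 §2 Definition 7.3 (p. 130)] -/
@[simp]
theorem map_inv_map_hom (P : A₁.toAffine.toAbelianVariety.Points Ω) :
    AlgPoints.map e.inv (AlgPoints.map e.hom P : A₂.toAffine.toAbelianVariety.Points Ω) = P := by
  rw [← AlgPoints.map_comp_apply, Iso.hom_inv_id, AlgPoints.map_id_apply]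

/-- `e(e⁻¹(Q)) = Q` on `Ω`-points. [cite: MumfordFogartyKirwan1994, Ch. 7 §2 Definition 7.3 (p. 130)] -/
@[simp]
theorem map_hom_map_inv (Q : A₂.toAffine.toAbelianVariety.Points Ω) :
    AlgPoints.map e.hom (AlgPoints.map e.inv Q : A₁.toAffine.toAbelianVariety.Points Ω) = Q := by
  rw [← AlgPoints.map_comp_apply, Iso.inv_hom_id, AlgPoints.map_id_apply]

/-- A homomorphism sends the unit point to the unit point (Mathlib `MonObj.one_comp`). [cite: Milne2005ShimuraVarieties, §14 pp. 124–125] -/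
theorem map_one_of_isMonHom (f : A₁.X ⟶ B.X) [IsMonHom f] :
    (AlgPoints.map f (1 : A₁.toAffine.toAbelianVariety.Points Ω) : B.toAffine.toAbelianVariety.Points Ω) = 1 :=
  MonObj.one_comp f

/-- A homomorphism is multiplicative on points (Mathlib `MonObj.mul_comp`). [cite: Milne2005ShimuraVarieties, §14 pp. 124–125] -/
theorem map_mul_of_isMonHom (f : A₁.X ⟶ B.X) [IsMonHom f] (P Q : A₁.toAffine.toAbelianVariety.Points Ω) :
    (AlgPoints.map f (P * Q) : B.toAffine.toAbelianVariety.Points Ω) = AlgPoints.map f P * AlgPoints.map f Q :=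
  MonObj.mul_comp P Q f

/-- **An isomorphism detects the unit point**: `e(P) = 1 ↔ P = 1`. [cite: Milne2005ShimuraVarieties, §14 pp. 124–125] -/
theorem map_eq_one_iff_of_iso_hom [IsMonHom e.hom] (P : A₁.toAffine.toAbelianVariety.Points Ω) :
    (AlgPoints.map e.hom P : A₂.toAffine.toAbelianVariety.Points Ω) = 1 ↔ P = 1 := by
  constructor
  · intro h
    have h' := congrArg (fun Q : A₂.toAffine.toAbelianVariety.Points Ω =>
      (AlgPoints.map e.inv Q : A₁.toAffine.toAbelianVariety.Points Ω)) h
    simpa only [map_inv_map_hom, map_one_of_isMonHom] using h'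
  · rintro rfl
    exact map_one_of_isMonHom e.hom

/-- `e⁻¹(Q) = 1 ↔ Q = 1`. [cite: Milne2005ShimuraVarieties, §14 pp. 124–125] -/
theorem map_eq_one_iff_of_iso_inv [IsMonHom e.hom] (Q : A₂.toAffine.toAbelianVariety.Points Ω) :
    (AlgPoints.map e.inv Q : A₁.toAffine.toAbelianVariety.Points Ω) = 1 ↔ Q = 1 := by
  haveI : IsMonHom e.symm.hom := (inferInstance : IsMonHom e.inv)
  exact map_eq_one_iff_of_iso_hom e.symm Q

/-- **The points of an isomorphism of group schemes form a MULTIPLICATIVE EQUIVALENCE** `A₁(Ω) ≃* A₂(Ω)` with `ε = e(·)`, `ε⁻¹ = e⁻¹(·)`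
(existence form; Mathlib `MulEquiv.mk'`). [cite: Milne2005ShimuraVarieties, §14 pp. 124–125] -/
theorem exists_mulEquiv_points_of_iso [IsMonHom e.hom] :
    ∃ ε : A₁.toAffine.toAbelianVariety.Points Ω ≃* A₂.toAffine.toAbelianVariety.Points Ω,
      (∀ P, ε P = AlgPoints.map e.hom P) ∧ ∀ Q, ε.symm Q = AlgPoints.map e.inv Q := by
  refine ⟨MulEquiv.mk' ⟨fun P => AlgPoints.map e.hom P, fun Q => AlgPoints.map e.inv Q, fun P => map_inv_map_hom e P,
    fun Q => map_hom_map_inv e Q⟩ (fun P Q => map_mul_of_isMonHom e.hom P Q), fun P => rfl, fun Q => rfl⟩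

/-- **Torsion predicates transport**: if `ι₁(a) ≫ e = e ≫ ι₂(a)` for all `a`, then `P` is killed by every `ι₁(a)`, `a ∈ 𝔞`, iff `e(P)` is
killed by every `ι₂(a)`, `a ∈ 𝔞` (`e` detects the unit point).  The `IsIdealTorsionΩ` clause of the P6a readers. [cite: Milne2005ShimuraVarieties, §14 pp. 124–125] -/
theorem forall_map_eq_one_iff_of_iso [IsMonHom e.hom] {O : Type*} (𝔞 : O → Prop) (act₁ : O → (A₁.X ⟶ A₁.X)) (act₂ : O → (A₂.X ⟶ A₂.X))
    (hact : ∀ a, act₁ a ≫ e.hom = e.hom ≫ act₂ a) (P : A₁.toAffine.toAbelianVariety.Points Ω) :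
    (∀ a, 𝔞 a → (AlgPoints.map (act₁ a) P : A₁.toAffine.toAbelianVariety.Points Ω) = 1) ↔
      ∀ a, 𝔞 a → (AlgPoints.map (act₂ a) (AlgPoints.map e.hom P : A₂.toAffine.toAbelianVariety.Points Ω) :
        A₂.toAffine.toAbelianVariety.Points Ω) = 1 := by
  refine forall₂_congr fun a _ => ?_
  rw [← AlgPoints.map_comp_apply, ← hact a, AlgPoints.map_comp_apply, map_eq_one_iff_of_iso_hom]

/-- The same read from side 2: `P₂` is `𝔞`-torsion iff `e⁻¹(P₂)` is. [cite: Milne2005ShimuraVarieties, §14 pp. 124–125] -/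
theorem forall_map_eq_one_iff_of_iso_inv [IsMonHom e.hom] {O : Type*} (𝔞 : O → Prop) (act₁ : O → (A₁.X ⟶ A₁.X))
    (act₂ : O → (A₂.X ⟶ A₂.X)) (hact : ∀ a, act₁ a ≫ e.hom = e.hom ≫ act₂ a) (Q : A₂.toAffine.toAbelianVariety.Points Ω) :
    (∀ a, 𝔞 a → (AlgPoints.map (act₂ a) Q : A₂.toAffine.toAbelianVariety.Points Ω) = 1) ↔
      ∀ a, 𝔞 a → (AlgPoints.map (act₁ a) (AlgPoints.map e.inv Q : A₁.toAffine.toAbelianVariety.Points Ω) :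
        A₁.toAffine.toAbelianVariety.Points Ω) = 1 := by
  rw [forall_map_eq_one_iff_of_iso e 𝔞 act₁ act₂ hact, map_hom_map_inv]

end Points

/-! ### §2 (r3) one-sided: the polarisation law `q ≫ λ_B ≫ q^∨ = λ ≫ [p]` along `e⁻¹ ≫ q` -/

section Lambda

variable {S : Scheme.{u}} [IsReduced S] [IsLocallyNoetherian S] {A₁ A₂ B : AbelianSchemeOver S}
  (D₁ : A₁.DualPair) (D₂ : A₂.DualPair) (DB : B.DualPair)
  (hD₁ : Nonempty ((Scheme.Modules.pullback (DualPair.unitHatSlice D₁)).obj D₁.P ≅ SheafOfModules.unit _))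
  (hD₂ : Nonempty ((Scheme.Modules.pullback (DualPair.unitHatSlice D₂)).obj D₂.P ≅ SheafOfModules.unit _))
  (lam₁ : A₁.X ⟶ D₁.hat.X) (lam₂ : A₂.X ⟶ D₂.hat.X) (lamB : B.X ⟶ DB.hat.X)
  (e : A₁.X ≅ A₂.X) [IsMonHom e.hom] (q : A₁.X ⟶ B.X) [IsMonHom q] (p : ℕ)

include hD₁ hD₂ in
/-- **(r3) TRANSPORTS**: if `e : A₁ ≅ A₂` is exact on `λ` (`e ≫ λ₂ ≫ e^∨ = λ₁`) and `q ≫ λ_B ≫ q^∨ = λ₁ ≫ [p]`, then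
`(e⁻¹ ≫ q) ≫ λ_B ≫ (e⁻¹ ≫ q)^∨ = λ₂ ≫ [p]` (`(e⁻¹ ≫ q)^∨ = q^∨ ≫ (e⁻¹)^∨` ★ `dualIsogenyOver_comp`; `[p]` commutes with the homomorphism
`(e⁻¹)^∨` ★ `comp_mulN_eq_mulN_comp`; `e⁻¹ ≫ λ₁ ≫ (e⁻¹)^∨ = λ₂` ★ `inv_comp_lam_comp_dualIsogenyOver_inv_of_eq`).
[cite: MumfordAV1970, §15 Thm. 1 (p. 143)] [cite: MilneAV2008, I §9 Thm. 9.1 (p. 42)] -/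
theorem comp_lam_comp_dualIsogenyOver_eq_mulN_of_iso_inv_comp
    (he : e.hom ≫ lam₂ ≫ DualPair.dualIsogenyOver e.hom D₁ D₂ = lam₁)
    (h : q ≫ lamB ≫ DualPair.dualIsogenyOver q D₁ DB = lam₁ ≫ D₁.hat.mulN p) :
    (e.inv ≫ q) ≫ lamB ≫ DualPair.dualIsogenyOver (e.inv ≫ q) D₂ DB = lam₂ ≫ D₂.hat.mulN p := by
  haveI : IsMonHom (DualPair.dualIsogenyOver e.inv D₂ D₁) := DualPair.isMonHom_dualIsogenyOver e.inv D₂ D₁ hD₁ hD₂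
  have he' : e.inv ≫ lam₁ ≫ DualPair.dualIsogenyOver e.inv D₂ D₁ = lam₂ :=
    inv_comp_lam_comp_dualIsogenyOver_inv_of_eq D₁ D₂ lam₁ lam₂ hD₂ e he
  rw [DualPair.dualIsogenyOver_comp e.inv q D₂ D₁ DB]
  simp only [Category.assoc]
  rw [reassoc_of% h, ← comp_mulN_eq_mulN_comp (DualPair.dualIsogenyOver e.inv D₂ D₁) p, ← he']
  simp only [Category.assoc]

end Lambda

/-! ### §3 The head: an isogeny roof transports along isomorphisms of the outer fibres -/

section Roof

variable {Ω : Type u} [Field Ω] {A₁ A₂ A₁'' A₂'' : AbelianSchemeOver (Spec (.of Ω))}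
  (D₁ : A₁.DualPair) (D₂ : A₂.DualPair) (D₁'' : A₁''.DualPair) (D₂'' : A₂''.DualPair)
  (hD₁ : Nonempty ((Scheme.Modules.pullback (DualPair.unitHatSlice D₁)).obj D₁.P ≅ SheafOfModules.unit _))
  (hD₂ : Nonempty ((Scheme.Modules.pullback (DualPair.unitHatSlice D₂)).obj D₂.P ≅ SheafOfModules.unit _))
  (hD₁'' : Nonempty ((Scheme.Modules.pullback (DualPair.unitHatSlice D₁'')).obj D₁''.P ≅ SheafOfModules.unit _))
  (hD₂'' : Nonempty ((Scheme.Modules.pullback (DualPair.unitHatSlice D₂'')).obj D₂''.P ≅ SheafOfModules.unit _))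
  (lam₁ : A₁.X ⟶ D₁.hat.X) (lam₂ : A₂.X ⟶ D₂.hat.X) (lam₁'' : A₁''.X ⟶ D₁''.hat.X) (lam₂'' : A₂''.X ⟶ D₂''.hat.X)
  {O : Type*} (act₁ : O → (A₁.X ⟶ A₁.X)) (act₂ : O → (A₂.X ⟶ A₂.X))
  (act₁'' : O → (A₁''.X ⟶ A₁''.X)) (act₂'' : O → (A₂''.X ⟶ A₂''.X))
  {J : Type*} (pt₁ : J → A₁.toAffine.toAbelianVariety.Points Ω) (pt₂ : J → A₂.toAffine.toAbelianVariety.Points Ω)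
  (pt₁'' : J → A₁''.toAffine.toAbelianVariety.Points Ω) (pt₂'' : J → A₂''.toAffine.toAbelianVariety.Points Ω)
  (tors₁'' : A₁''.toAffine.toAbelianVariety.Points Ω → Prop) (tors₂'' : A₂''.toAffine.toAbelianVariety.Points Ω → Prop)
  (K₁ : Subgroup (A₁.toAffine.toAbelianVariety.Points Ω)) (K₂ : Subgroup (A₂.toAffine.toAbelianVariety.Points Ω))
  (e : A₁.X ≅ A₂.X) [IsMonHom e.hom] (e'' : A₁''.X ≅ A₂''.X) [IsMonHom e''.hom] (p : ℕ)

include hD₁ hD₂ hD₁'' hD₂'' in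
/-- **THE ISOGENY ROOF TRANSPORTS ALONG ISOMORPHISMS OF THE OUTER FIBRES.**  Let `e : A₁ ≅ A₂` and `e″ : A₁″ ≅ A₂″` be isomorphisms of
group schemes over `Spec Ω`, exact on the polarisations in dual-homomorphism form (`he`, `he″`), on the endomorphism families (`hact`, `hact″`),
on the chosen point families (`hpt`, `hpt″`), on the torsion predicates (`htors`: `tors₂″ Q ↔ tors₁″ (e″⁻¹ Q)`) and on the kernels
(`hK`: `Q ∈ K₂ ↔ e⁻¹ Q ∈ K₁`).  Then an isogeny roof `A₁ —q→ B ←c— A₁″` with the clauses (r1)–(r5) of the P6a reader `RoofΩ` for side 1 yields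
the isogeny roof `A₂ —(e⁻¹ ≫ q)→ B ←(e″⁻¹ ≫ c)— A₂″` with the same clauses for side 2 (same middle object `(B, B̂, λ_B)`, same `p`, same common
endomorphisms `b`).  (r1)(r2)(r5): §1; surjectivity of `e″⁻¹ ≫ c`: `e″⁻¹` is a homeomorphism; (r3): §2; (r4): conjugation.
[cite: MumfordAV1970, §15 Thm. 1 (p. 143); §23 Thm. 2 (p. 231)] [cite: MumfordFogartyKirwan1994, Ch. 7 §2 Definition 7.2 (p. 129) and Definition 7.3 (p. 130)]
[cite: Milne2005ShimuraVarieties, §14 pp. 124–125] -/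
theorem roof_transport_along_iso
    (he : e.hom ≫ lam₂ ≫ DualPair.dualIsogenyOver e.hom D₁ D₂ = lam₁)
    (he'' : e''.hom ≫ lam₂'' ≫ DualPair.dualIsogenyOver e''.hom D₁'' D₂'' = lam₁'')
    (hact : ∀ a, act₁ a ≫ e.hom = e.hom ≫ act₂ a) (hact'' : ∀ a, act₁'' a ≫ e''.hom = e''.hom ≫ act₂'' a)
    (hpt : ∀ i, (AlgPoints.map e.hom (pt₁ i) : A₂.toAffine.toAbelianVariety.Points Ω) = pt₂ i)
    (hpt'' : ∀ i, (AlgPoints.map e''.hom (pt₁'' i) : A₂''.toAffine.toAbelianVariety.Points Ω) = pt₂'' i)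
    (htors : ∀ Q, tors₂'' Q ↔ tors₁'' (AlgPoints.map e''.inv Q))
    (hK : ∀ Q, Q ∈ K₂ ↔ (AlgPoints.map e.inv Q : A₁.toAffine.toAbelianVariety.Points Ω) ∈ K₁)
    (hroof : ∃ (B : AbelianSchemeOver (Spec (.of Ω))) (DB : B.DualPair) (lamB : B.X ⟶ DB.hat.X) (_ : IsMonHom lamB)
        (_ : Nonempty ((Scheme.Modules.pullback DB.unitHatSlice).obj DB.P ≅ SheafOfModules.unit _))
        (q : A₁.X ⟶ B.X) (_ : IsMonHom q) (c : A₁''.X ⟶ B.X) (_ : IsMonHom c),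
        (∀ P : A₁.toAffine.toAbelianVariety.Points Ω,
            (AlgPoints.map q P : B.toAffine.toAbelianVariety.Points Ω) = 1 ↔ P ∈ K₁) ∧
        (∀ P : A₁''.toAffine.toAbelianVariety.Points Ω,
            (AlgPoints.map c P : B.toAffine.toAbelianVariety.Points Ω) = 1 ↔ tors₁'' P) ∧
        Function.Surjective c.left.base ∧
        q ≫ lamB ≫ DualPair.dualIsogenyOver q D₁ DB = lam₁ ≫ D₁.hat.mulN p ∧
        c ≫ lamB ≫ DualPair.dualIsogenyOver c D₁'' DB = lam₁'' ≫ D₁''.hat.mulN p ∧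
        (∀ a : O, ∃ b : B.X ⟶ B.X, act₁ a ≫ q = q ≫ b ∧ act₁'' a ≫ c = c ≫ b) ∧
        (∀ i : J, (AlgPoints.map q (pt₁ i) : B.toAffine.toAbelianVariety.Points Ω) = AlgPoints.map c (pt₁'' i))) :
    ∃ (B : AbelianSchemeOver (Spec (.of Ω))) (DB : B.DualPair) (lamB : B.X ⟶ DB.hat.X) (_ : IsMonHom lamB)
        (_ : Nonempty ((Scheme.Modules.pullback DB.unitHatSlice).obj DB.P ≅ SheafOfModules.unit _))
        (q : A₂.X ⟶ B.X) (_ : IsMonHom q) (c : A₂''.X ⟶ B.X) (_ : IsMonHom c),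
        (∀ P : A₂.toAffine.toAbelianVariety.Points Ω,
            (AlgPoints.map q P : B.toAffine.toAbelianVariety.Points Ω) = 1 ↔ P ∈ K₂) ∧
        (∀ P : A₂''.toAffine.toAbelianVariety.Points Ω,
            (AlgPoints.map c P : B.toAffine.toAbelianVariety.Points Ω) = 1 ↔ tors₂'' P) ∧
        Function.Surjective c.left.base ∧
        q ≫ lamB ≫ DualPair.dualIsogenyOver q D₂ DB = lam₂ ≫ D₂.hat.mulN p ∧
        c ≫ lamB ≫ DualPair.dualIsogenyOver c D₂'' DB = lam₂'' ≫ D₂''.hat.mulN p ∧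
        (∀ a : O, ∃ b : B.X ⟶ B.X, act₂ a ≫ q = q ≫ b ∧ act₂'' a ≫ c = c ≫ b) ∧
        (∀ i : J, (AlgPoints.map q (pt₂ i) : B.toAffine.toAbelianVariety.Points Ω) = AlgPoints.map c (pt₂'' i)) := by
  obtain ⟨B, DB, lamB, hlamB, hDBu, q, hq, c, hc, r1, r2, hsurj, r3, r3'', r4, r5⟩ := hroof
  haveI : IsMonHom e.inv := inferInstance
  haveI : IsMonHom e''.inv := inferInstance
  refine ⟨B, DB, lamB, hlamB, hDBu, e.inv ≫ q, inferInstance, e''.inv ≫ c, inferInstance, fun P => ?_, fun P => ?_, ?_,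
    comp_lam_comp_dualIsogenyOver_eq_mulN_of_iso_inv_comp D₁ D₂ DB hD₁ hD₂ lam₁ lam₂ lamB e q p he r3,
    comp_lam_comp_dualIsogenyOver_eq_mulN_of_iso_inv_comp D₁'' D₂'' DB hD₁'' hD₂'' lam₁'' lam₂'' lamB e'' c p he'' r3'',
    fun a => ?_, fun i => ?_⟩
  · -- (r1) kernel of `e⁻¹ ≫ q` on points
    rw [AlgPoints.map_comp_apply, r1, hK]
  · -- (r2) kernel of `e″⁻¹ ≫ c` on points
    rw [AlgPoints.map_comp_apply, r2, htors]
  · -- `e″⁻¹ ≫ c` is surjective: `e″⁻¹` is an isomorphism of schemes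
    haveI : IsIso e''.inv.left := (inferInstance : IsIso ((Over.forget _).map e''.inv))
    rw [Over.comp_left, Scheme.Hom.comp_base, TopCat.coe_comp]
    exact hsurj.comp (TopCat.homeoOfIso (Scheme.forgetToTop.mapIso (asIso e''.inv.left))).surjective
  · -- (r4) equivariance through the same endomorphism of `B`
    obtain ⟨b, hbq, hbc⟩ := r4 a
    refine ⟨b, ?_, ?_⟩
    · have h1 : act₂ a ≫ e.inv = e.inv ≫ act₁ a := by
        rw [Iso.comp_inv_eq, Category.assoc, hact a, Iso.inv_hom_id_assoc]
      rw [← Category.assoc, h1, Category.assoc, hbq, Category.assoc]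
    · have h1 : act₂'' a ≫ e''.inv = e''.inv ≫ act₁'' a := by
        rw [Iso.comp_inv_eq, Category.assoc, hact'' a, Iso.inv_hom_id_assoc]
      rw [← Category.assoc, h1, Category.assoc, hbc, Category.assoc]
  · -- (r5) the chosen points correspond
    rw [AlgPoints.map_comp_apply, AlgPoints.map_comp_apply, ← hpt i, ← hpt'' i, map_inv_map_hom, map_inv_map_hom]
    exact r5 i

end Roof

end AbelianSchemeOver

end Literature.AlgebraicGeometry.AbelianSchemes

end
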